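import Summits.ABC.ABC.Theses.CuspFieldPencil
import Summits.ABC.ABC.Theorems.GoldenFieldClassNumberOne
import HarnessLib

/-!
# The golden instance: number-field pencil theorem ⇒ golden cusp shadow

`Summits/ABC/ABC/Theorems/CuspFieldPencilGoldenFromNFPencil.lean` — proves the support item
stmt-ABC-26251 `Summit.ABC.ABC.Theses.CuspFieldPencil.GoldenFromNFPencil` of the (draft)
class-record route `CuspFieldPencil` (LINE 17):

`NFPencilBound → GoldenCuspShadow`.

**Proof.** Apply `NFPencilBound` to the cusp field `K = ℚ(√5)`, modelled as Mathlib's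
`QuadraticAlgebra ℚ 1 1` (`ω² = 1 + ω`, `ω = φ`; class number one is the checkpoint
`GoldenField.ringOfIntegers_isPrincipalIdealRing`), with `k = 4` and the four cusp forms of `X₁(5)`
over `𝓞_K`: `u`, `w`, `L₂ = u + β₂w`, `L₃ = u + β₃w`, `β₂ = −3 − 5θ = −φ⁵`, `β₃ = −8 + 5θ = φ⁻⁵`
(`θ = ω ∈ 𝓞_K`), pairwise non-proportional, with `L₂L₃ = u² − 11uw − w² =: Q` and
`∏ Lᵢ = uwQ`. NORM BOOKKEEPING (`Gᵢ = N(rad(Lᵢ𝓞_K))`): for a rational integer `n ≠ 0`,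
`N(rad(n𝓞_K)) ≤ N(rad(n)𝓞_K) = rad(n)²` (`rad(n𝓞_K) = rad(rad(n)𝓞_K)` as `rad n ∣ n ∣ rad(n)^k`), so
`G₀ ≤ rad(u)²`, `G₁ ≤ rad(w)²`; for the conjugate pair, in the Dedekind domain `𝓞_K`,
`rad L₂ · rad L₃ = (rad L₂ ⊔ rad L₃)(rad L₂ ⊓ rad L₃) = (rad L₂ ⊔ rad L₃) · rad(L₂L₃)` and
`5√5 = 5(2θ−1) ∈ (L₂, L₃)` (`L₃ − L₂ = 5√5·w`, `β₃L₂ − β₂L₃ = 5√5·u`, `au + bw = 1`), whence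
`G₂G₃ ≤ C₀ · N(rad(Q𝓞_K)) ≤ C₀ · rad(Q)²` with the absolute constant `C₀ = N(5√5·𝓞_K)` (`= 125`,
value not needed). As `u, w, Q` are pairwise coprime, `∏ Gᵢ ≤ C₀ · rad(uwQ)²`, and the pencil
bound with `ε/2` gives `log max(|u|,|w|) ≤ C (∏Gᵢ)^{1/4+ε/2} ≤ C⁺ C₀^{1/4+ε/2} · rad(uwQ)^{1/2+ε}`.

HONESTY. Bookkeeping theorem of a CLASS RECORD at abc distance 0 (width 0): it specialises the
OPEN, UNPROVED parametric number-field pencil theorem `NFPencilBound` (stmt-ABC-26250); NOT abc,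
NOT A-PS; abc moved by 0; typed ≠ proved.

References: Scoones, Mathematika 70 (2023) = arXiv:2111.07791 (only through `NFPencilBound`);
Marcus, *Number Fields* Ch. 3 (ideal factorisation); [folklore].
-/

set_option linter.dupNamespace false

namespace Summit.ABC.ABC.Theorems

open NumberField UniqueFactorizationMonoid QuadraticAlgebra

namespace GoldenFromNFPencil

/-! ## §1 Ideal-norm bookkeeping in a ring of integers -/

/-- In a Dedekind domain with finite quotients:
`N(rad I)·N(rad J) = N(rad I ⊔ rad J)·N(rad(IJ))` (`gcd · lcm = product`). [folklore] -/
theorem absNorm_radical_mul_absNorm_radical {R : Type*} [CommRing R] [IsDedekindDomain R]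
    [Module.Free ℤ R] [Module.Finite ℤ R] (I J : Ideal R) :
    Ideal.absNorm I.radical * Ideal.absNorm J.radical =
      Ideal.absNorm (I.radical ⊔ J.radical) * Ideal.absNorm (I * J).radical := by
  rw [← map_mul, ← Ideal.sup_mul_inf, map_mul, Ideal.radical_mul, ← Ideal.radical_inf]

/-- If `c ∈ I ⊔ J` and `N(c) ≠ 0` then `N(rad I ⊔ rad J) ≤ N((c))`. [folklore] -/
theorem absNorm_sup_radical_le {R : Type*} [CommRing R] [IsDedekindDomain R]
    [Module.Free ℤ R] [Module.Finite ℤ R] (I J : Ideal R) (c : R)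
    (hc : c ∈ I ⊔ J) (hc0 : Ideal.absNorm (Ideal.span {c}) ≠ 0) :
    Ideal.absNorm (I.radical ⊔ J.radical) ≤ Ideal.absNorm (Ideal.span {c}) := by
  refine Nat.le_of_dvd (Nat.pos_of_ne_zero hc0) (Ideal.absNorm_dvd_absNorm_of_le ?_)
  rw [Ideal.span_singleton_le_iff_mem]
  have h : I ⊔ J ≤ I.radical ⊔ J.radical := sup_le_sup Ideal.le_radical Ideal.le_radical
  exact h hc

/-- `rad((n)) = rad((r))` when `r ∣ n ∣ r ^ k`. [folklore] -/
theorem radical_span_eq_of_dvd_of_dvd_pow {R : Type*} [CommRing R] {n r : R} {k : ℕ}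
    (h1 : r ∣ n) (h2 : n ∣ r ^ k) :
    (Ideal.span {n}).radical = (Ideal.span {r}).radical := by
  apply le_antisymm
  · exact Ideal.radical_mono (Ideal.span_singleton_le_span_singleton.mpr h1)
  · rw [Ideal.radical_le_radical_iff, Ideal.span_singleton_le_iff_mem]
    exact ⟨k, Ideal.mem_span_singleton.mpr h2⟩

/-- For a rational integer `n ≠ 0` in the ring of integers of a number field `K`:
`N(rad(n𝓞_K)) ≤ rad(n)^[K:ℚ]` (since `rad(n𝓞_K) = rad(rad(n)𝓞_K) ⊇ rad(n)𝓞_K` and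
`N(m𝓞_K) = |m|^[K:ℚ]`). [folklore] -/
theorem absNorm_radical_span_intCast_le (K : Type*) [Field K] [NumberField K] (n : ℤ)
    (hn : n ≠ 0) :
    Ideal.absNorm (Ideal.span {(n : 𝓞 K)}).radical ≤
      (radical n).natAbs ^ Module.finrank ℚ K := by
  obtain ⟨k, hk⟩ := exists_dvd_radical_self_pow hn
  have h1 : ((radical n : ℤ) : 𝓞 K) ∣ (n : 𝓞 K) := by
    obtain ⟨m, hm⟩ := radical_dvd_self (a := n)
    exact ⟨(m : 𝓞 K), by rw [← Int.cast_mul, ← hm]⟩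
  have h2 : (n : 𝓞 K) ∣ ((radical n : ℤ) : 𝓞 K) ^ k := by
    obtain ⟨m, hm⟩ := hk
    exact ⟨(m : 𝓞 K), by rw [← Int.cast_pow, ← Int.cast_mul, ← hm]⟩
  rw [radical_span_eq_of_dvd_of_dvd_pow h1 h2]
  have hr0 : Ideal.absNorm (Ideal.span {((radical n : ℤ) : 𝓞 K)}) ≠ 0 := by
    rw [Ne, Ideal.absNorm_eq_zero_iff, Ideal.span_singleton_eq_bot]
    exact_mod_cast radical_ne_zero
  refine (Nat.le_of_dvd (Nat.pos_of_ne_zero hr0)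
    (Ideal.absNorm_dvd_absNorm_of_le Ideal.le_radical)).trans (le_of_eq ?_)
  rw [Ideal.absNorm_span_singleton, ← eq_intCast (algebraMap ℤ (𝓞 K)), Algebra.norm_algebraMap,
    Int.natAbs_pow, RingOfIntegers.rank]

/-! ## §2 Integer bookkeeping: `u, w, Q` pairwise coprime -/

/-- `gcd(u, w) = 1 ⇒ gcd(u, u² − 11uw − w²) = 1`. [folklore] -/
theorem isCoprime_quadForm_left {u w : ℤ} (h : IsCoprime u w) :
    IsCoprime u (u ^ 2 - 11 * u * w - w ^ 2) := by
  have h1 : IsCoprime u (-(w ^ 2)) := h.pow_right.neg_right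
  have h2 : u ^ 2 - 11 * u * w - w ^ 2 = -(w ^ 2) + u * (u - 11 * w) := by ring
  rw [h2]
  exact h1.add_mul_left_right _

/-- `gcd(u, w) = 1 ⇒ gcd(w, u² − 11uw − w²) = 1`. [folklore] -/
theorem isCoprime_quadForm_right {u w : ℤ} (h : IsCoprime u w) :
    IsCoprime w (u ^ 2 - 11 * u * w - w ^ 2) := by
  have h1 : IsCoprime w (u ^ 2) := h.symm.pow_right
  have h2 : u ^ 2 - 11 * u * w - w ^ 2 = u ^ 2 + w * (-11 * u - w) := by ring
  rw [h2]
  exact h1.add_mul_left_right _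

/-- For coprime `u, w`: `rad(u·w·Q) = rad u · rad w · rad Q` in absolute value,
`Q = u² − 11uw − w²`. [folklore] -/
theorem natAbs_radical_prod {u w : ℤ} (h : IsCoprime u w) :
    (radical (u * w * (u ^ 2 - 11 * u * w - w ^ 2))).natAbs =
      (radical u).natAbs * (radical w).natAbs *
        (radical (u ^ 2 - 11 * u * w - w ^ 2)).natAbs := by
  have h12 : IsRelPrime (u * w) (u ^ 2 - 11 * u * w - w ^ 2) :=
    ((isCoprime_quadForm_left h).mul_left (isCoprime_quadForm_right h)).isRelPrime
  rw [radical_mul h12, radical_mul h.isRelPrime, Int.natAbs_mul, Int.natAbs_mul]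

/-! ## §3 The cusp forms of `X₁(5)`: ring identities -/

/-- With `θ² = θ + 1`, `β₂ = −3 − 5θ`, `β₃ = −8 + 5θ`:
`(u + β₂ w)(u + β₃ w) = u² − 11uw − w²` (`β₂ + β₃ = −11`, `β₂β₃ = −1`). [folklore] -/
theorem formTwo_mul_formThree {R : Type*} [CommRing R] (θ u w : R) (hθ : θ * θ = θ + 1) :
    (1 * u + (-3 - 5 * θ) * w) * (1 * u + (-8 + 5 * θ) * w) =
      u ^ 2 - 11 * u * w - w ^ 2 := by
  linear_combination (-(25 : R) * w ^ 2) * hθ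

/-- The product of the four cusp forms `u, w, u + β₂w, u + β₃w` is `u·w·(u² − 11uw − w²)`.
[folklore] -/
theorem prod_forms {R : Type*} [CommRing R] (θ u w β₂ β₃ : R) (h₂ : β₂ = -3 - 5 * θ)
    (h₃ : β₃ = -8 + 5 * θ) (hθ : θ * θ = θ + 1) :
    ∏ i : Fin 4, ((![1, 0, 1, 1] : Fin 4 → R) i * u + (![0, 1, β₂, β₃] : Fin 4 → R) i * w) =
      u * w * (u ^ 2 - 11 * u * w - w ^ 2) := by
  rw [Fin.prod_univ_four]
  simp only [Matrix.cons_val_zero, Matrix.cons_val_one, Matrix.cons_val]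
  rw [h₂, h₃]
  linear_combination (-(25 : R) * u * w ^ 3) * hθ

/-- `5√5 = 5(2θ − 1)` lies in the ideal `(u + β₂w, u + β₃w)` whenever `au + bw = 1`:
`(β₃ − β₂)u = β₃L₂ − β₂L₃`, `(β₃ − β₂)w = L₃ − L₂`, `β₃ − β₂ = 5(2θ−1)`. [folklore] -/
theorem sqrtFive_mem_sup {R : Type*} [CommRing R] (θ u w β₂ β₃ a b : R) (h₂ : β₂ = -3 - 5 * θ)
    (h₃ : β₃ = -8 + 5 * θ) (hab : a * u + b * w = 1) :
    5 * (2 * θ - 1) ∈ Ideal.span {1 * u + β₂ * w} ⊔ Ideal.span {1 * u + β₃ * w} := by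
  rw [Submodule.mem_sup]
  refine ⟨(a * β₃ - b) * (1 * u + β₂ * w), Ideal.mul_mem_left _ _ (Ideal.mem_span_singleton_self _),
    (b - a * β₂) * (1 * u + β₃ * w), Ideal.mul_mem_left _ _ (Ideal.mem_span_singleton_self _), ?_⟩
  rw [h₂, h₃]
  linear_combination (5 * (2 * θ - 1)) * hab

/-! ## §4 The golden field: specific elements of `𝓞 ℚ(√5)` -/

section Golden

variable [Fact (∀ r : ℚ, r ^ 2 ≠ (1 : ℚ) + 1 * r)]

/-- `θ = ω ∈ 𝓞_K` satisfies `θ² = θ + 1`. [folklore] -/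
theorem theta_mul_theta :
    (⟨ω, GoldenField.isIntegral_omega⟩ : 𝓞 (QuadraticAlgebra ℚ 1 1)) *
        ⟨ω, GoldenField.isIntegral_omega⟩ =
      ⟨ω, GoldenField.isIntegral_omega⟩ + 1 := by
  rw [RingOfIntegers.mk_mul_mk, ← RingOfIntegers.mk_one, RingOfIntegers.mk_add_mk,
    RingOfIntegers.mk_eq_mk]
  ext <;> simp

/-- The image in `K` of `p + q·θ ∈ 𝓞_K` has coordinates `(p, q)`. [folklore] -/
theorem coe_lin (p q : ℤ) :
    algebraMap (𝓞 (QuadraticAlgebra ℚ 1 1)) (QuadraticAlgebra ℚ 1 1)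
        ((p : 𝓞 (QuadraticAlgebra ℚ 1 1)) + (q : 𝓞 (QuadraticAlgebra ℚ 1 1)) *
          ⟨ω, GoldenField.isIntegral_omega⟩) = ⟨(p : ℚ), (q : ℚ)⟩ := by
  simp only [map_add, map_mul, map_intCast, RingOfIntegers.map_mk]
  ext <;> simp

/-- `p + qθ = 0` in `𝓞_K` forces `q = 0`. [folklore] -/
theorem lin_ne_zero (p q : ℤ) (hq : q ≠ 0) :
    (p : 𝓞 (QuadraticAlgebra ℚ 1 1)) + (q : 𝓞 (QuadraticAlgebra ℚ 1 1)) *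
        ⟨ω, GoldenField.isIntegral_omega⟩ ≠ 0 := by
  intro h
  have h' := congrArg (fun x => (algebraMap (𝓞 (QuadraticAlgebra ℚ 1 1)) (QuadraticAlgebra ℚ 1 1)
    x).im) h
  simp only [coe_lin, map_zero, im_zero] at h'
  exact hq (by exact_mod_cast h')

end Golden

/-! ## §5 The golden instance -/

/-- Real-arithmetic step: from `L ≤ C · P^e` with `P ≤ C₀ · R²` (naturals), `e = 1/4 + ε/2 ≥ 0`,
deduce `L ≤ (max C 0 · C₀^e) · R^{1/2+ε}`. [folklore] -/
theorem real_step {L C ε : ℝ} {P C₀ R : ℕ} (hε : 0 < ε)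
    (hL : L ≤ C * (P : ℝ) ^ (1 / (4 : ℝ) + ε / 2)) (hP : P ≤ C₀ * R ^ 2) :
    L ≤ (max C 0 * (C₀ : ℝ) ^ (1 / (4 : ℝ) + ε / 2)) * (R : ℝ) ^ (1 / 2 + ε : ℝ) := by
  set e : ℝ := 1 / (4 : ℝ) + ε / 2 with he
  have he0 : 0 ≤ e := by rw [he]; positivity
  have hPR : (P : ℝ) ≤ (C₀ : ℝ) * (R : ℝ) ^ 2 := by exact_mod_cast hP
  have hPe : (P : ℝ) ^ e ≤ ((C₀ : ℝ) * (R : ℝ) ^ 2) ^ e :=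
    Real.rpow_le_rpow (Nat.cast_nonneg _) hPR he0
  have hsplit : ((C₀ : ℝ) * (R : ℝ) ^ 2) ^ e = (C₀ : ℝ) ^ e * (R : ℝ) ^ (1 / 2 + ε : ℝ) := by
    rw [Real.mul_rpow (Nat.cast_nonneg _) (pow_nonneg (Nat.cast_nonneg _) 2)]
    congr 1
    rw [show ((R : ℝ) ^ 2) = (R : ℝ) ^ (2 : ℝ) by norm_cast, ← Real.rpow_mul (Nat.cast_nonneg _)]
    congr 1
    rw [he]; ring
  have hPe0 : 0 ≤ (P : ℝ) ^ e := Real.rpow_nonneg (Nat.cast_nonneg _) e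
  calc L ≤ C * (P : ℝ) ^ e := hL
    _ ≤ max C 0 * (P : ℝ) ^ e := mul_le_mul_of_nonneg_right (le_max_left _ _) hPe0
    _ ≤ max C 0 * (((C₀ : ℝ) * (R : ℝ) ^ 2) ^ e) :=
        mul_le_mul_of_nonneg_left hPe (le_max_right _ _)
    _ = (max C 0 * (C₀ : ℝ) ^ e) * (R : ℝ) ^ (1 / 2 + ε : ℝ) := by rw [hsplit, mul_assoc]

end GoldenFromNFPencil

open GoldenFromNFPencil in
/-- Support item stmt-ABC-26251: the parametric number-field pencil theorem `NFPencilBound`,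
specialised to the golden instance `K = ℚ(√5)` (class number one), `k = 4`, forms
`u, w, u − φ⁵w, u + φ⁻⁵w`, yields the golden cusp shadow `GoldenCuspShadow`
(`∏ Gᵢ ≤ N(5√5)·rad(uwQ)²`, exponent `1/4 + ε/2 ↦ 1/2 + ε`). -/
theorem goldenFromNFPencil_proof : Summit.ABC.ABC.Theses.CuspFieldPencil.GoldenFromNFPencil := by
  unfold Summit.ABC.ABC.Theses.CuspFieldPencil.GoldenFromNFPencil
    Summit.ABC.ABC.Theses.CuspFieldPencil.NFPencilBound
    Summit.ABC.ABC.Theses.CuspFieldPencil.GoldenCuspShadow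
  intro hNF ε hε
  haveI hfact : Fact (∀ r : ℚ, r ^ 2 ≠ (1 : ℚ) + 1 * r) := ⟨GoldenField.golden_fact⟩
  haveI : NumberField (QuadraticAlgebra ℚ (1 : ℚ) 1) := GoldenField.numberField
  -- names for the specific algebraic integers
  obtain ⟨θ, hθdef⟩ : ∃ θ : 𝓞 (QuadraticAlgebra ℚ (1 : ℚ) 1), θ = ⟨ω, GoldenField.isIntegral_omega⟩ :=
    ⟨_, rfl⟩
  obtain ⟨β₂, h₂⟩ : ∃ x : 𝓞 (QuadraticAlgebra ℚ (1 : ℚ) 1), x = -3 - 5 * θ := ⟨_, rfl⟩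
  obtain ⟨β₃, h₃⟩ : ∃ x : 𝓞 (QuadraticAlgebra ℚ (1 : ℚ) 1), x = -8 + 5 * θ := ⟨_, rfl⟩
  obtain ⟨c, hc⟩ : ∃ x : 𝓞 (QuadraticAlgebra ℚ (1 : ℚ) 1), x = 5 * (2 * θ - 1) := ⟨_, rfl⟩
  have hθ : θ * θ = θ + 1 := by rw [hθdef]; exact theta_mul_theta
  -- the specific non-vanishings, via the `ω`-coordinate
  have hβ₂0 : β₂ ≠ 0 := by
    have := lin_ne_zero (-3) (-5) (by norm_num)
    rw [h₂, hθdef]; convert this using 1; push_cast; ring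
  have hβ₃0 : β₃ ≠ 0 := by
    have := lin_ne_zero (-8) 5 (by norm_num)
    rw [h₃, hθdef]; convert this using 1; push_cast; ring
  have hβ23 : β₂ ≠ β₃ := by
    intro h
    have := lin_ne_zero 5 (-10) (by norm_num)
    apply this
    rw [← sub_eq_zero] at h
    rw [h₂, h₃, hθdef] at h
    rw [← h]; push_cast; ring
  have hc0 : c ≠ 0 := by
    have := lin_ne_zero (-5) 10 (by norm_num)
    rw [hc, hθdef]; convert this using 1; push_cast; ring
  -- the forms
  let α : Fin 4 → 𝓞 (QuadraticAlgebra ℚ (1 : ℚ) 1) := ![1, 0, 1, 1]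
  let β : Fin 4 → 𝓞 (QuadraticAlgebra ℚ (1 : ℚ) 1) := ![0, 1, β₂, β₃]
  have hprop : ∀ i j : Fin 4, i ≠ j → α i * β j ≠ α j * β i := by
    intro i j hij
    fin_cases i <;> fin_cases j <;>
      simp [α, β, hβ₂0, hβ₃0, hβ23, hβ23.symm, hβ₂0.symm, hβ₃0.symm] at hij ⊢
  obtain ⟨C, hC⟩ := hNF (QuadraticAlgebra ℚ (1 : ℚ) 1) GoldenField.ringOfIntegers_isPrincipalIdealRing
    4 α β (by norm_num) hprop (ε / 2) (by positivity)
  -- the absolute constant `C₀ = N(5√5 · 𝓞_K)`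
  refine ⟨max C 0 * (Ideal.absNorm (Ideal.span {c}) : ℝ) ^ (1 / (4 : ℝ) + ε / 2), ?_⟩
  intro u w hcop hne
  have hu : u ≠ 0 := fun h => hne (by rw [h]; ring)
  have hw : w ≠ 0 := fun h => hne (by rw [h]; ring)
  have hQ : u ^ 2 - 11 * u * w - w ^ 2 ≠ 0 := fun h => hne (by rw [h]; ring)
  -- the product of the forms is `uwQ ≠ 0`
  have hprod : ∏ i, (α i * (u : 𝓞 (QuadraticAlgebra ℚ (1 : ℚ) 1)) + β i * (w : 𝓞 (QuadraticAlgebra ℚ (1 : ℚ) 1))) =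
      ((u * w * (u ^ 2 - 11 * u * w - w ^ 2) : ℤ) : 𝓞 (QuadraticAlgebra ℚ (1 : ℚ) 1)) := by
    rw [prod_forms θ _ _ β₂ β₃ h₂ h₃ hθ]; push_cast; ring
  have hprod0 : ∏ i, (α i * (u : 𝓞 (QuadraticAlgebra ℚ (1 : ℚ) 1)) + β i * (w : 𝓞 (QuadraticAlgebra ℚ (1 : ℚ) 1))) ≠ 0 := by
    rw [hprod]; exact_mod_cast hne
  have hmain := hC u w hcop hprod0
  -- norm bookkeeping
  have hG : ∏ i, Ideal.absNorm (Ideal.span {α i * (u : 𝓞 (QuadraticAlgebra ℚ (1 : ℚ) 1)) +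
      β i * (w : 𝓞 (QuadraticAlgebra ℚ (1 : ℚ) 1))}).radical ≤ Ideal.absNorm (Ideal.span {c}) *
      (radical (u * w * (u ^ 2 - 11 * u * w - w ^ 2))).natAbs ^ 2 := by
    rw [Fin.prod_univ_four]
    simp only [α, β, Matrix.cons_val_zero, Matrix.cons_val_one, Matrix.cons_val, one_mul, zero_mul,
      add_zero, zero_add]
    have hfin : Module.finrank ℚ (QuadraticAlgebra ℚ (1 : ℚ) 1) = 2 := GoldenField.finrank_eq_two
    have hGu := absNorm_radical_span_intCast_le (QuadraticAlgebra ℚ (1 : ℚ) 1) u hu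
    have hGw := absNorm_radical_span_intCast_le (QuadraticAlgebra ℚ (1 : ℚ) 1) w hw
    have hGQ := absNorm_radical_span_intCast_le (QuadraticAlgebra ℚ (1 : ℚ) 1) _ hQ
    rw [hfin] at hGu hGw hGQ
    -- the conjugate pair
    obtain ⟨a, b, hab⟩ := hcop
    have hcmem : c ∈ Ideal.span {(u : 𝓞 (QuadraticAlgebra ℚ (1 : ℚ) 1)) + β₂ * w} ⊔
        Ideal.span {(u : 𝓞 (QuadraticAlgebra ℚ (1 : ℚ) 1)) + β₃ * w} := by
      have hab' : (a : 𝓞 (QuadraticAlgebra ℚ (1 : ℚ) 1)) * (u : 𝓞 (QuadraticAlgebra ℚ (1 : ℚ) 1)) +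
          (b : 𝓞 (QuadraticAlgebra ℚ (1 : ℚ) 1)) * (w : 𝓞 (QuadraticAlgebra ℚ (1 : ℚ) 1)) = 1 := by
        rw [← Int.cast_mul, ← Int.cast_mul, ← Int.cast_add, hab, Int.cast_one]
      have := sqrtFive_mem_sup θ (u : 𝓞 (QuadraticAlgebra ℚ (1 : ℚ) 1))
        (w : 𝓞 (QuadraticAlgebra ℚ (1 : ℚ) 1)) β₂ β₃ _ _ h₂ h₃ hab'
      simpa only [hc, one_mul] using this
    have hcN : Ideal.absNorm (Ideal.span {c}) ≠ 0 := by
      rw [Ne, Ideal.absNorm_eq_zero_iff, Ideal.span_singleton_eq_bot]; exact hc0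
    have hpair := absNorm_radical_mul_absNorm_radical
      (Ideal.span {(u : 𝓞 (QuadraticAlgebra ℚ (1 : ℚ) 1)) + β₂ * w})
      (Ideal.span {(u : 𝓞 (QuadraticAlgebra ℚ (1 : ℚ) 1)) + β₃ * w})
    have hsup := absNorm_sup_radical_le _ _ c hcmem hcN
    have hQK : Ideal.span {(u : 𝓞 (QuadraticAlgebra ℚ (1 : ℚ) 1)) + β₂ * w} *
        Ideal.span {(u : 𝓞 (QuadraticAlgebra ℚ (1 : ℚ) 1)) + β₃ * w} =
        Ideal.span {((u ^ 2 - 11 * u * w - w ^ 2 : ℤ) : 𝓞 (QuadraticAlgebra ℚ (1 : ℚ) 1))} := by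
      rw [Ideal.span_singleton_mul_span_singleton]
      congr 2
      have := formTwo_mul_formThree θ (u : 𝓞 (QuadraticAlgebra ℚ (1 : ℚ) 1)) (w : 𝓞 (QuadraticAlgebra ℚ (1 : ℚ) 1)) hθ
      rw [← h₂, ← h₃, one_mul] at this
      rw [this]; push_cast; ring
    rw [hQK] at hpair
    -- assemble in ℕ
    rw [natAbs_radical_prod ⟨a, b, hab⟩]
    have h23 : Ideal.absNorm (Ideal.span {(u : 𝓞 (QuadraticAlgebra ℚ (1 : ℚ) 1)) + β₂ * w}).radical *
        Ideal.absNorm (Ideal.span {(u : 𝓞 (QuadraticAlgebra ℚ (1 : ℚ) 1)) + β₃ * w}).radical ≤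
        Ideal.absNorm (Ideal.span {c}) * (radical (u ^ 2 - 11 * u * w - w ^ 2)).natAbs ^ 2 := by
      rw [hpair]; exact Nat.mul_le_mul hsup hGQ
    calc _ = (Ideal.absNorm (Ideal.span {(u : 𝓞 (QuadraticAlgebra ℚ (1 : ℚ) 1))}).radical *
          Ideal.absNorm (Ideal.span {(w : 𝓞 (QuadraticAlgebra ℚ (1 : ℚ) 1))}).radical) *
          (Ideal.absNorm (Ideal.span {(u : 𝓞 (QuadraticAlgebra ℚ (1 : ℚ) 1)) + β₂ * w}).radical *
          Ideal.absNorm (Ideal.span {(u : 𝓞 (QuadraticAlgebra ℚ (1 : ℚ) 1)) + β₃ * w}).radical) := by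
          ring
      _ ≤ ((radical u).natAbs ^ 2 * (radical w).natAbs ^ 2) *
          (Ideal.absNorm (Ideal.span {c}) * (radical (u ^ 2 - 11 * u * w - w ^ 2)).natAbs ^ 2) :=
          Nat.mul_le_mul (Nat.mul_le_mul hGu hGw) h23
      _ = _ := by ring
  -- real arithmetic
  have hlhs : Real.log (((max |u| |w| : ℤ)) : ℝ) = Real.log (max |(u : ℝ)| |(w : ℝ)|) := by
    push_cast; rfl
  rw [← hlhs]
  have hexp : (1 / ((4 : ℕ) : ℝ) + ε / 2) = (1 / (4 : ℝ) + ε / 2) := by norm_num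
  rw [hexp] at hmain
  exact real_step hε hmain hG

end Summit.ABC.ABC.Theorems
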